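import Mathlib
import HarnessLib
import Literature.MathematicalPhysics.QuantumLattice.HubbardUVGridPieceMomentLinear
import Summits.HubbardSuperconductivity.HubbardSuperconductivity.Theorems.KLProgrammeKLRegimeEngineScaleZeroE4Bands

/-!
# Route `KLProgramme`, crux K3 child ENGINE (`KLRegimeEngineV14`, stmt-HubbardSuperconductivity-19918), stub `stub_engine_scale0`,
# conjunct (E4)₀: the first SPACE MOMENT of the scale-`0` covariance of an admissible frame, telescoped over the frame pieces —
# `(β/N)·Σ_{a,b⃗} |b̃_l|·‖S[G](a,b⃗)‖ ≤ C₀(B) + C₁(B)·(1 + ΣGfr)⁴·((N_sc+1)·U² + 2|U|)`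

Cell gate-hubbard-kl, seat hubbard-kl-k3c2-p1 g3 (the space part `A_X` of the weighted decay constant `α_w` of (E4)₀, design of record;
the time part `A_T` is k3c4-p2's `timeMoment_scaleZero_of_klEng`).  For the character sum `S[G]` of the padded symbol
`G = gridSymbol L M N β (uvSymbolCT L M β μ K klE0) σ` of the scale-`0` covariance `C^K_{>e₀}` (`2M ≤ N`): writing `G = G_{b_{N_sc+1}}`
with the partial frame bands `bₘ` of `…ScaleZeroE4Bands` and telescoping (`HubbardUVGridSymbolBand.sum_sum_wt_norm_charSum_telescope_le`),
the bare piece is bounded by `HubbardUVBandPieces.spaceMoment_basePiece_le` (band `e − μ`, `‖Dⁱ‖ ≤ 4ⁱ`, scale `R = 1`) and the `m`-th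
increment by `spaceMoment_incrPiece_le` at the one-scale data `D = D_c·2ᵐ`, `W(i) = Gfr i·u_i(U)·(2ᵐ)^{2i}/(2ᵐ)⁴`, space scale `R = 4ᵐ`;
after linearisation (`uvSpaceMomentConst_le_linear`) every term is `O(U²)` or `O(|U|·2^{-m})` UNIFORMLY in `m`
(`scale_bracket_eq`: `4ᵐ·(1/(4·4ᵐ))^{k-1}·(2ᵐ)ʲ·(2ᵐ)^{2(k-j)}/(2ᵐ)⁴ = 4^{1-k}·2^{-mj}`), whence the sum over `m ≤ N_sc`.

* `scale_bracket_eq`, `scale_bracket_le`; `scaledIncrQ_le`, `scaledIncrQ'_le` — the per-piece amplitudes at their own scale;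
* `spaceMoment_incrPiece_frame_le`, `spaceMoment_basePiece_frame_le` — the pieces of an admissible frame;
* **`spaceMoment_scaleZero_of_frameOK`** — the export (`klBetaMin ≤ β`, `β³ ≤ M`, `2M ≤ N`, `|U| ≤ 1`, `R.WF`, cutoff derivatives `≤ B`
  up to order `5`, `l ≠ l'`).
-/

noncomputable section

namespace Summit.HubbardSuperconductivity.HubbardSuperconductivity.Theorems.EngineV8

set_option linter.dupNamespace false -- summit = problem name (single-conjunct summit), D-0017

open Real Finset Literature.MathematicalPhysics.QuantumLattice Literature.Probability.LatticeModels
open Summit.HubbardSuperconductivity.HubbardSuperconductivity.Theorems.KLRegimeSplit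
open Summit.HubbardSuperconductivity.HubbardSuperconductivity.Theorems.DispersionFlow
open Summit.HubbardSuperconductivity.HubbardSuperconductivity.Theorems.ScaleZeroDecay

variable {L M N : ℕ}

/-! ## §1 The scale bookkeeping -/

/-- **The scale bracket**: `Y²·(1/(4Y²))^{k'}·Yʲ·(Y^{2d}/Y⁴) = (1/4)^{k'}·(1/Y)ʲ` for `j + d = k' + 1` (`Y ≠ 0`). -/
theorem scale_bracket_eq {Y : ℝ} (hY : Y ≠ 0) {k' j d : ℕ} (hjd : j + d = k' + 1) :
    Y ^ 2 * (1 / (4 * Y ^ 2)) ^ k' * Y ^ j * (Y ^ (2 * d) / Y ^ 4) = (1 / 4) ^ k' * (1 / Y) ^ j := by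
  have key : Y ^ 2 * Y ^ j * Y ^ (2 * d) * Y ^ j = (Y ^ 2) ^ k' * Y ^ 4 := by
    rw [← pow_add, ← pow_add, ← pow_add, ← pow_mul, ← pow_add]
    congr 1
    omega
  have hYj : Y ^ j ≠ 0 := pow_ne_zero _ hY
  have key' : Y ^ 2 * Y ^ j * Y ^ (2 * d) = (Y ^ 2) ^ k' * Y ^ 4 / Y ^ j := by
    rw [eq_div_iff hYj]; exact key
  calc Y ^ 2 * (1 / (4 * Y ^ 2)) ^ k' * Y ^ j * (Y ^ (2 * d) / Y ^ 4)
      = Y ^ 2 * Y ^ j * Y ^ (2 * d) / ((4 : ℝ) ^ k' * (Y ^ 2) ^ k' * Y ^ 4) := by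
        rw [div_pow, one_pow, mul_pow]; ring
    _ = (Y ^ 2) ^ k' * Y ^ 4 / Y ^ j / ((4 : ℝ) ^ k' * (Y ^ 2) ^ k' * Y ^ 4) := by rw [key']
    _ = (1 / 4) ^ k' * (1 / Y) ^ j := by
        have h4 : (4 : ℝ) ^ k' ≠ 0 := pow_ne_zero _ (by norm_num)
        have hY2 : (Y ^ 2) ^ k' ≠ 0 := pow_ne_zero _ (pow_ne_zero _ hY)
        have hY4 : Y ^ 4 ≠ 0 := pow_ne_zero _ hY
        rw [div_pow, div_pow, one_pow, one_pow, div_div, div_eq_iff (by positivity), div_mul_div_comm, one_mul, one_div,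
          inv_mul_eq_div, eq_div_iff (by positivity)]
        ring

/-- The scale bracket is at most `(1/Y)ʲ ≤ 1`, and at most `1/Y` when `j ≥ 1` (`Y ≥ 1`). -/
theorem scale_bracket_le {Y : ℝ} (hY : 1 ≤ Y) {k' j d : ℕ} (hjd : j + d = k' + 1) :
    Y ^ 2 * (1 / (4 * Y ^ 2)) ^ k' * Y ^ j * (Y ^ (2 * d) / Y ^ 4) ≤ (1 / Y) ^ j := by
  rw [scale_bracket_eq (by positivity) hjd]
  have h1 : (1 / 4 : ℝ) ^ k' ≤ 1 := pow_le_one₀ (by norm_num) (by norm_num)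
  have h2 : 0 ≤ (1 / Y) ^ j := by positivity
  nlinarith

/-! ## §2 The amplitudes of the `m`-th increment at their own scale -/

section Pieces

variable {R : RenConsts} {U : ℝ} {Nsc : ℕ} {Kp : ℕ → TrigPolyC4v} {B : ℝ}

/-- **The inner sum of the increment amplitude, scaled**: with `Y = 2ᵐ`, `D = D_c·Y`, `W(i) = Gfr i·u_i(U)·Y^{2i}/Y⁴`,
`S = 1 + Gfr 0 + Gfr 1 + Gfr 2 + Gfr 3`, for `k = 1 + k' ≤ 3`:
`Y²·(1/(4Y²))^{k'}·Σ_{j ≤ k} C(k,j)·j!·Dʲ·W(k−j) ≤ 4608·S⁴·(U² + |U|·(1/2)ᵐ)` (`|U| ≤ 1`, `R.WF`). -/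
theorem scaled_incr_sum_le (hRwf : R.WF) (hU1 : |U| ≤ 1) (m : ℕ) {k' : ℕ} (hk' : k' ≤ 2) :
    ((2 : ℝ) ^ m) ^ 2 * (1 / (4 * ((2 : ℝ) ^ m) ^ 2)) ^ k' *
        ∑ j ∈ range (1 + k' + 1), ((1 + k').choose j : ℝ) * (j.factorial : ℝ) *
          ((4 + 4 / 3 * (R.Gfr 1 + R.Gfr 2 + R.Gfr 3)) * (2 : ℝ) ^ m) ^ j *
            (R.Gfr (1 + k' - j) * uPow (1 + k' - j) U * (((2 : ℝ) ^ m) ^ (2 * (1 + k' - j)) / ((2 : ℝ) ^ m) ^ 4)) ≤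
      4608 * (1 + R.Gfr 0 + R.Gfr 1 + R.Gfr 2 + R.Gfr 3) ^ 4 * (U ^ 2 + |U| * (1 / 2 : ℝ) ^ m) := by
  have hG0 : ∀ j, 0 ≤ R.Gfr j := hRwf.2.2
  set Y : ℝ := (2 : ℝ) ^ m with hYdef
  have hY1 : 1 ≤ Y := one_le_pow₀ (by norm_num)
  have hY0 : 0 < Y := by positivity
  set S : ℝ := 1 + R.Gfr 0 + R.Gfr 1 + R.Gfr 2 + R.Gfr 3 with hSdef
  have hS1 : 1 ≤ S := by rw [hSdef]; linarith [hG0 0, hG0 1, hG0 2, hG0 3]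
  have hGS : ∀ i ≤ 3, R.Gfr i ≤ S := by
    intro i hi; interval_cases i <;> rw [hSdef] <;> linarith [hG0 0, hG0 1, hG0 2, hG0 3]
  set Dc : ℝ := 4 + 4 / 3 * (R.Gfr 1 + R.Gfr 2 + R.Gfr 3) with hDc
  have hDc1 : 1 ≤ Dc := by rw [hDc]; nlinarith [hG0 1, hG0 2, hG0 3]
  have hDcS : Dc ≤ 4 * S := by rw [hDc, hSdef]; nlinarith [hG0 0, hG0 1, hG0 2, hG0 3]
  have hDcj : ∀ j ≤ 3, Dc ^ j ≤ 64 * S ^ 3 := by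
    intro j hj
    calc Dc ^ j ≤ Dc ^ 3 := pow_le_pow_right₀ hDc1 hj
      _ ≤ (4 * S) ^ 3 := pow_le_pow_left₀ (by linarith) hDcS 3
      _ = 64 * S ^ 3 := by ring
  have hU2 : U ^ 2 ≤ |U| := by nlinarith [abs_nonneg U, sq_abs U]
  -- termwise bound
  have hterm : ∀ j ∈ range (1 + k' + 1), ((1 + k').choose j : ℝ) * (j.factorial : ℝ) * (Dc * Y) ^ j *
      (R.Gfr (1 + k' - j) * uPow (1 + k' - j) U * (Y ^ (2 * (1 + k' - j)) / Y ^ 4)) * (Y ^ 2 * (1 / (4 * Y ^ 2)) ^ k') ≤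
      1152 * S ^ 4 * (U ^ 2 + |U| * (1 / 2 : ℝ) ^ m) := by
    intro j hj
    have hjk : j ≤ 1 + k' := by have := mem_range.1 hj; omega
    set d := 1 + k' - j with hd
    have hjd : j + d = k' + 1 := by omega
    have hchoose : ((1 + k').choose j : ℝ) ≤ 3 := by
      have : (1 + k').choose j ≤ 3 := by
        interval_cases k' <;> interval_cases j <;> simp [Nat.choose]
      exact_mod_cast this
    have hfact : (j.factorial : ℝ) ≤ 6 := by
      have : j.factorial ≤ 6 := by interval_cases k' <;> interval_cases j <;> simp [Nat.factorial]
      exact_mod_cast this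
    have hbr := scale_bracket_le hY1 hjd
    have hbr0 : 0 ≤ Y ^ 2 * (1 / (4 * Y ^ 2)) ^ k' * Y ^ j * (Y ^ (2 * d) / Y ^ 4) := by positivity
    -- the `u·bracket` factor: `≤ U² + |U|(1/2)^m`
    have hub : uPow d U * (Y ^ 2 * (1 / (4 * Y ^ 2)) ^ k' * Y ^ j * (Y ^ (2 * d) / Y ^ 4)) ≤ U ^ 2 + |U| * (1 / 2 : ℝ) ^ m := by
      unfold uPow
      split_ifs with hd0
      · -- `d = 0`: `j = k' + 1 ≥ 1`, bracket `≤ (1/Y)^j ≤ 1/Y = (1/2)^m`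
        have hj1 : 1 ≤ j := by omega
        have h1 : (1 / Y) ^ j ≤ (1 / 2 : ℝ) ^ m := by
          calc (1 / Y) ^ j ≤ (1 / Y) ^ 1 := pow_le_pow_of_le_one (by positivity) (div_le_one_of_le₀ hY1 hY0.le) hj1
            _ = (1 / 2 : ℝ) ^ m := by rw [pow_one, hYdef, one_div_pow]
        nlinarith [abs_nonneg U, sq_nonneg U, hbr, hbr0, h1]
      · -- `d ≥ 1`: `u = U²`, bracket `≤ 1`
        have h1 : (1 / Y) ^ j ≤ 1 := pow_le_one₀ (by positivity) (div_le_one_of_le₀ hY1 hY0.le)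
        nlinarith [abs_nonneg U, sq_nonneg U, hbr, hbr0, h1, show 0 ≤ |U| * (1 / 2 : ℝ) ^ m by positivity]
    have hGd : R.Gfr d ≤ S := hGS d (by omega)
    calc ((1 + k').choose j : ℝ) * (j.factorial : ℝ) * (Dc * Y) ^ j * (R.Gfr d * uPow d U * (Y ^ (2 * d) / Y ^ 4)) *
          (Y ^ 2 * (1 / (4 * Y ^ 2)) ^ k')
        = ((1 + k').choose j : ℝ) * (j.factorial : ℝ) * Dc ^ j * R.Gfr d *
            (uPow d U * (Y ^ 2 * (1 / (4 * Y ^ 2)) ^ k' * Y ^ j * (Y ^ (2 * d) / Y ^ 4))) := by rw [mul_pow]; ring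
      _ ≤ 3 * 6 * (64 * S ^ 3) * S * (U ^ 2 + |U| * (1 / 2 : ℝ) ^ m) := by
          have huP0 : 0 ≤ uPow d U * (Y ^ 2 * (1 / (4 * Y ^ 2)) ^ k' * Y ^ j * (Y ^ (2 * d) / Y ^ 4)) := by
            have : 0 ≤ uPow d U := by unfold uPow; split_ifs <;> positivity
            positivity
          have hS0 : 0 ≤ S := by linarith
          have hCF : ((1 + k').choose j : ℝ) * (j.factorial : ℝ) ≤ 3 * 6 := mul_le_mul hchoose hfact (Nat.cast_nonneg _) (by norm_num)
          have h1 : ((1 + k').choose j : ℝ) * (j.factorial : ℝ) * Dc ^ j ≤ 3 * 6 * (64 * S ^ 3) :=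
            mul_le_mul hCF (hDcj j (by omega)) (by positivity) (by norm_num)
          have h2 : ((1 + k').choose j : ℝ) * (j.factorial : ℝ) * Dc ^ j * R.Gfr d ≤ 3 * 6 * (64 * S ^ 3) * S :=
            mul_le_mul h1 hGd (hG0 d) (by positivity)
          exact mul_le_mul h2 hub huP0 (by positivity)
      _ = 1152 * S ^ 4 * (U ^ 2 + |U| * (1 / 2 : ℝ) ^ m) := by ring
  -- sum the termwise bound (`k + 1 ≤ 4` terms)
  rw [mul_sum]
  calc ∑ j ∈ range (1 + k' + 1), Y ^ 2 * (1 / (4 * Y ^ 2)) ^ k' * (((1 + k').choose j : ℝ) * (j.factorial : ℝ) * (Dc * Y) ^ j *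
        (R.Gfr (1 + k' - j) * uPow (1 + k' - j) U * (Y ^ (2 * (1 + k' - j)) / Y ^ 4)))
      ≤ ∑ _j ∈ range (1 + k' + 1), 1152 * S ^ 4 * (U ^ 2 + |U| * (1 / 2 : ℝ) ^ m) :=
        sum_le_sum fun j hj => by rw [mul_comm]; exact hterm j hj
    _ = (1 + k' + 1 : ℕ) * (1152 * S ^ 4 * (U ^ 2 + |U| * (1 / 2 : ℝ) ^ m)) := by rw [sum_const, card_range, nsmul_eq_mul]
    _ ≤ 4 * (1152 * S ^ 4 * (U ^ 2 + |U| * (1 / 2 : ℝ) ^ m)) := by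
        refine mul_le_mul_of_nonneg_right ?_ (by positivity)
        have : (1 + k' + 1 : ℕ) ≤ 4 := by omega
        exact_mod_cast this
    _ = 4608 * S ^ 4 * (U ^ 2 + |U| * (1 / 2 : ℝ) ^ m) := by ring

/-- **The scaled value amplitude of the `m`-th increment**: `4ᵐ·(1/(4·4ᵐ))^{k'}·uvIncrQ(1+k') ≤ B(k'+3)!(4/Λ)^{k'+2}·4608·S⁴·(U² + |U|/2ᵐ)`. -/
theorem scaledIncrQ_le (hRwf : R.WF) (hU1 : |U| ≤ 1) {Λ : ℝ} (hΛ : 0 < Λ) (hB1 : 1 ≤ B) (m : ℕ) {k' : ℕ} (hk' : k' ≤ 2) :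
    ((2 : ℝ) ^ m) ^ 2 * (1 / (4 * ((2 : ℝ) ^ m) ^ 2)) ^ k' *
        uvIncrQ B Λ ((4 + 4 / 3 * (R.Gfr 1 + R.Gfr 2 + R.Gfr 3)) * (2 : ℝ) ^ m)
          (fun i => R.Gfr i * uPow i U * (((2 : ℝ) ^ m) ^ (2 * i) / ((2 : ℝ) ^ m) ^ 4)) (1 + k') ≤
      B * ((1 + k' + 2).factorial : ℝ) * (4 / Λ) ^ (1 + k' + 1) *
        (4608 * (1 + R.Gfr 0 + R.Gfr 1 + R.Gfr 2 + R.Gfr 3) ^ 4 * (U ^ 2 + |U| * (1 / 2 : ℝ) ^ m)) := by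
  have h := scaled_incr_sum_le hRwf hU1 m hk'
  unfold uvIncrQ
  calc _ = B * ((1 + k' + 2).factorial : ℝ) * (4 / Λ) ^ (1 + k' + 1) *
        (((2 : ℝ) ^ m) ^ 2 * (1 / (4 * ((2 : ℝ) ^ m) ^ 2)) ^ k' *
          ∑ j ∈ range (1 + k' + 1), ((1 + k').choose j : ℝ) * (j.factorial : ℝ) *
            ((4 + 4 / 3 * (R.Gfr 1 + R.Gfr 2 + R.Gfr 3)) * (2 : ℝ) ^ m) ^ j *
              (R.Gfr (1 + k' - j) * uPow (1 + k' - j) U * (((2 : ℝ) ^ m) ^ (2 * (1 + k' - j)) / ((2 : ℝ) ^ m) ^ 4))) := by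
          ring
    _ ≤ _ := mul_le_mul_of_nonneg_left h (by positivity)

/-- **The scaled step amplitude of the `m`-th increment**: the same with `(k'+4)!`, `(4/Λ)^{k'+3}`. -/
theorem scaledIncrQ'_le (hRwf : R.WF) (hU1 : |U| ≤ 1) {Λ : ℝ} (hΛ : 0 < Λ) (hB1 : 1 ≤ B) (m : ℕ) {k' : ℕ} (hk' : k' ≤ 2) :
    ((2 : ℝ) ^ m) ^ 2 * (1 / (4 * ((2 : ℝ) ^ m) ^ 2)) ^ k' *
        uvIncrQ' B Λ ((4 + 4 / 3 * (R.Gfr 1 + R.Gfr 2 + R.Gfr 3)) * (2 : ℝ) ^ m)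
          (fun i => R.Gfr i * uPow i U * (((2 : ℝ) ^ m) ^ (2 * i) / ((2 : ℝ) ^ m) ^ 4)) (1 + k') ≤
      B * ((1 + k' + 3).factorial : ℝ) * (4 / Λ) ^ (1 + k' + 2) *
        (4608 * (1 + R.Gfr 0 + R.Gfr 1 + R.Gfr 2 + R.Gfr 3) ^ 4 * (U ^ 2 + |U| * (1 / 2 : ℝ) ^ m)) := by
  have h := scaled_incr_sum_le hRwf hU1 m hk'
  unfold uvIncrQ'
  calc _ = B * ((1 + k' + 3).factorial : ℝ) * (4 / Λ) ^ (1 + k' + 2) *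
        (((2 : ℝ) ^ m) ^ 2 * (1 / (4 * ((2 : ℝ) ^ m) ^ 2)) ^ k' *
          ∑ j ∈ range (1 + k' + 1), ((1 + k').choose j : ℝ) * (j.factorial : ℝ) *
            ((4 + 4 / 3 * (R.Gfr 1 + R.Gfr 2 + R.Gfr 3)) * (2 : ℝ) ^ m) ^ j *
              (R.Gfr (1 + k' - j) * uPow (1 + k' - j) U * (((2 : ℝ) ^ m) ^ (2 * (1 + k' - j)) / ((2 : ℝ) ^ m) ^ 4))) := by
          ring
    _ ≤ _ := mul_le_mul_of_nonneg_left h (by positivity)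

end Pieces

/-! ## §3 The pieces of an admissible frame -/

section Frame

variable [NeZero L] [NeZero N] {R : RenConsts} {U μ β : ℝ} {Nsc : ℕ} {Kp : ℕ → TrigPolyC4v} {B : ℝ}

/-- `0 < klE0 ≤ 4`. -/
theorem klE0_pos_le_four : (0 : ℝ) < klE0 ∧ klE0 ≤ 4 := by norm_num [klE0]

/-- The increment amplitudes are non-negative (`B ≥ 1`, `R.WF`). -/
theorem uvIncrQ_frame_nonneg (hRwf : R.WF) (hB1 : 1 ≤ B) (m k : ℕ) :
    0 ≤ uvIncrQ B klE0 ((4 + 4 / 3 * (R.Gfr 1 + R.Gfr 2 + R.Gfr 3)) * (2 : ℝ) ^ m)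
        (fun i => R.Gfr i * uPow i U * (((2 : ℝ) ^ m) ^ (2 * i) / ((2 : ℝ) ^ m) ^ 4)) k ∧
      0 ≤ uvIncrQ' B klE0 ((4 + 4 / 3 * (R.Gfr 1 + R.Gfr 2 + R.Gfr 3)) * (2 : ℝ) ^ m)
        (fun i => R.Gfr i * uPow i U * (((2 : ℝ) ^ m) ^ (2 * i) / ((2 : ℝ) ^ m) ^ 4)) k := by
  have hG0 : ∀ j, 0 ≤ R.Gfr j := hRwf.2.2
  have hΛ := klE0_pos_le_four.1
  have hsum : 0 ≤ ∑ j ∈ Finset.range (k + 1), (k.choose j : ℝ) * (j.factorial : ℝ) *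
      ((4 + 4 / 3 * (R.Gfr 1 + R.Gfr 2 + R.Gfr 3)) * (2 : ℝ) ^ m) ^ j *
        (R.Gfr (k - j) * uPow (k - j) U * (((2 : ℝ) ^ m) ^ (2 * (k - j)) / ((2 : ℝ) ^ m) ^ 4)) :=
    sum_nonneg fun j _ => by
      have h1 : 0 ≤ uPow (k - j) U := by unfold uPow; split_ifs <;> positivity
      have h2 : 0 ≤ (4 + 4 / 3 * (R.Gfr 1 + R.Gfr 2 + R.Gfr 3)) * (2 : ℝ) ^ m := by nlinarith [hG0 1, hG0 2, hG0 3, pow_pos (by norm_num : (0:ℝ) < 2) m]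
      have h3 := hG0 (k - j)
      positivity
  unfold uvIncrQ uvIncrQ'
  constructor <;> positivity

/-- **The first space moment of the `m`-th INCREMENT of an admissible frame** (`m ≤ N_sc`):
`(β/N)·Σ|b̃_l|·‖S[G_{b_{m+1}} − G_{bₘ}]‖ ≤ C_lin(B)·4608·S⁴·(U² + |U|/2ᵐ)`. -/
theorem spaceMoment_incrPiece_frame_le (hRwf : R.WF) (hU1 : |U| ≤ 1)
    (hS : ∀ n ≤ Nsc, ∀ j ≤ 4, ∀ q : Momentum, ‖iteratedFDeriv ℝ j (evalM (Kp n)) q‖ ≤ R.Gfr j * uPow j U * (4 : ℝ) ^ (((j : ℤ) - 2) * n))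
    (hβ2 : 2 ≤ β) (hβM : β ^ 3 ≤ (M : ℝ)) (hMN : 2 * M ≤ N) (hB1 : 1 ≤ B)
    (hB : ∀ i ≤ 5, ∀ t, ‖iteratedDeriv i salmhoferCutoff t‖ ≤ B) {m : ℕ} (hm : m ≤ Nsc) {l l' : Fin 2} (hll' : l ≠ l') :
    β / N * ∑ a : TorusSite 1 N, ∑ bv : TorusSite 2 L,
        |(((bv l).valMinAbs : ℤ) : ℝ)| *
          ‖∑ q₀ : TorusSite 1 N, ∑ qv : TorusSite 2 L, torusChar q₀ a * torusChar qv bv *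
            (uvGridSymbolBand L M N β klE0 (fun y => frameLevel μ 0 (WithLp.toLp 2 (latticeMomentum L y)) -
                ∑ n ∈ range (m + 1), evalM (Kp n) (WithLp.toLp 2 (latticeMomentum L y))) -
              uvGridSymbolBand L M N β klE0 (fun y => frameLevel μ 0 (WithLp.toLp 2 (latticeMomentum L y)) -
                ∑ n ∈ range m, evalM (Kp n) (WithLp.toLp 2 (latticeMomentum L y)))) q₀ qv‖ ≤
      (1 / 4 * Real.sqrt (216 * (1 / klE0 + 1 / 2)) *
          ∑ e : Fin 2 × Fin 2, (uvLinV klE0 (1 + (e.1 : ℕ) + (e.2 : ℕ)) *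
              (B * ((1 + ((e.1 : ℕ) + (e.2 : ℕ)) + 2).factorial : ℝ) * (4 / klE0) ^ (1 + ((e.1 : ℕ) + (e.2 : ℕ)) + 1)) +
            uvLinD klE0 (1 + (e.1 : ℕ) + (e.2 : ℕ)) *
              (B * ((1 + ((e.1 : ℕ) + (e.2 : ℕ)) + 3).factorial : ℝ) * (4 / klE0) ^ (1 + ((e.1 : ℕ) + (e.2 : ℕ)) + 2)))) *
        (4608 * (1 + R.Gfr 0 + R.Gfr 1 + R.Gfr 2 + R.Gfr 3) ^ 4 * (U ^ 2 + |U| * (1 / 2 : ℝ) ^ m)) := by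
  obtain ⟨hΛ, hΛ4⟩ := klE0_pos_le_four
  -- rewrite the band of `G_{m+1}` as `bₘ + (−Kₘ)`
  have hband : (fun y : TorusSite 2 L => frameLevel μ 0 (WithLp.toLp 2 (latticeMomentum L y)) -
      ∑ n ∈ range (m + 1), evalM (Kp n) (WithLp.toLp 2 (latticeMomentum L y))) =
      fun y => (fun q : EuclideanSpace ℝ (Fin 2) => frameLevel μ 0 q - ∑ n ∈ range m, evalM (Kp n) q)
        (WithLp.toLp 2 (latticeMomentum L y)) +
        (fun q : EuclideanSpace ℝ (Fin 2) => -evalM (Kp m) q) (WithLp.toLp 2 (latticeMomentum L y)) := by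
    funext y; exact frameBandSeq_succ μ Kp m _
  rw [hband]
  have hstep := spaceMoment_incrPiece_le (L := L) (M := M) (N := N) hβ2 hΛ hΛ4 hβM hMN hB1 hB le_rfl
    (contDiff_frameBandSeq μ Kp m) (contDiff_evalM_neg (Kp m)) (frameBandSeq_periodic μ Kp m) (evalM_neg_periodic (Kp m))
    (D := (4 + 4 / 3 * (R.Gfr 1 + R.Gfr 2 + R.Gfr 3)) * (2 : ℝ) ^ m)
    (fun s hs i hi1 hi3 x => norm_iteratedFDeriv_frameBandInterp_le hRwf hU1 hS hm hs hi1 hi3 x)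
    (W := fun i => R.Gfr i * uPow i U * (((2 : ℝ) ^ m) ^ (2 * i) / ((2 : ℝ) ^ m) ^ 4))
    (fun i hi x => norm_iteratedFDeriv_framePiece_le hS hm (by omega) x) hll' (R := 4 ^ m) (Nat.one_le_pow _ _ (by norm_num))
  refine hstep.trans ?_
  have hQ := fun k => (uvIncrQ_frame_nonneg (U := U) hRwf hB1 m k).1
  have hQ' := fun k => (uvIncrQ_frame_nonneg (U := U) hRwf hB1 m k).2
  refine (uvSpaceMomentConst_le_linear hΛ (4 ^ m) hQ hQ').trans ?_
  have h4m : ((4 ^ m : ℕ) : ℝ) = ((2 : ℝ) ^ m) ^ 2 := by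
    push_cast; rw [← pow_mul, mul_comm, pow_mul]; norm_num
  rw [h4m, mul_assoc (1 / 4 * Real.sqrt (216 * (1 / klE0 + 1 / 2))), mul_sum, mul_assoc (1 / 4 * Real.sqrt (216 * (1 / klE0 + 1 / 2))),
    sum_mul]
  refine mul_le_mul_of_nonneg_left (sum_le_sum fun e _ => ?_) (by positivity)
  have hk' : (e.1 : ℕ) + (e.2 : ℕ) ≤ 2 := by have := e.1.isLt; have := e.2.isLt; omega
  have hV := scaledIncrQ_le hRwf hU1 hΛ hB1 m hk'
  have hD := scaledIncrQ'_le hRwf hU1 hΛ hB1 m hk'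
  have hV0 := uvLinV_nonneg hΛ (1 + (e.1 : ℕ) + (e.2 : ℕ))
  have hD0 := uvLinD_nonneg hΛ (1 + (e.1 : ℕ) + (e.2 : ℕ))
  rw [show 1 + (e.1 : ℕ) + (e.2 : ℕ) = 1 + ((e.1 : ℕ) + (e.2 : ℕ)) by ring] at hV0 hD0 ⊢
  calc ((2 : ℝ) ^ m) ^ 2 * ((1 / (4 * ((2 : ℝ) ^ m) ^ 2)) ^ ((e.1 : ℕ) + (e.2 : ℕ)) *
        (uvLinV klE0 (1 + ((e.1 : ℕ) + (e.2 : ℕ))) *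
            uvIncrQ B klE0 ((4 + 4 / 3 * (R.Gfr 1 + R.Gfr 2 + R.Gfr 3)) * (2 : ℝ) ^ m)
              (fun i => R.Gfr i * uPow i U * (((2 : ℝ) ^ m) ^ (2 * i) / ((2 : ℝ) ^ m) ^ 4)) (1 + ((e.1 : ℕ) + (e.2 : ℕ))) +
          uvLinD klE0 (1 + ((e.1 : ℕ) + (e.2 : ℕ))) *
            uvIncrQ' B klE0 ((4 + 4 / 3 * (R.Gfr 1 + R.Gfr 2 + R.Gfr 3)) * (2 : ℝ) ^ m)
              (fun i => R.Gfr i * uPow i U * (((2 : ℝ) ^ m) ^ (2 * i) / ((2 : ℝ) ^ m) ^ 4)) (1 + ((e.1 : ℕ) + (e.2 : ℕ)))))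
      = uvLinV klE0 (1 + ((e.1 : ℕ) + (e.2 : ℕ))) *
          (((2 : ℝ) ^ m) ^ 2 * (1 / (4 * ((2 : ℝ) ^ m) ^ 2)) ^ ((e.1 : ℕ) + (e.2 : ℕ)) *
            uvIncrQ B klE0 ((4 + 4 / 3 * (R.Gfr 1 + R.Gfr 2 + R.Gfr 3)) * (2 : ℝ) ^ m)
              (fun i => R.Gfr i * uPow i U * (((2 : ℝ) ^ m) ^ (2 * i) / ((2 : ℝ) ^ m) ^ 4)) (1 + ((e.1 : ℕ) + (e.2 : ℕ)))) +
        uvLinD klE0 (1 + ((e.1 : ℕ) + (e.2 : ℕ))) *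
          (((2 : ℝ) ^ m) ^ 2 * (1 / (4 * ((2 : ℝ) ^ m) ^ 2)) ^ ((e.1 : ℕ) + (e.2 : ℕ)) *
            uvIncrQ' B klE0 ((4 + 4 / 3 * (R.Gfr 1 + R.Gfr 2 + R.Gfr 3)) * (2 : ℝ) ^ m)
              (fun i => R.Gfr i * uPow i U * (((2 : ℝ) ^ m) ^ (2 * i) / ((2 : ℝ) ^ m) ^ 4)) (1 + ((e.1 : ℕ) + (e.2 : ℕ)))) := by ring
    _ ≤ uvLinV klE0 (1 + ((e.1 : ℕ) + (e.2 : ℕ))) * (B * ((1 + ((e.1 : ℕ) + (e.2 : ℕ)) + 2).factorial : ℝ) *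
          (4 / klE0) ^ (1 + ((e.1 : ℕ) + (e.2 : ℕ)) + 1) *
          (4608 * (1 + R.Gfr 0 + R.Gfr 1 + R.Gfr 2 + R.Gfr 3) ^ 4 * (U ^ 2 + |U| * (1 / 2 : ℝ) ^ m))) +
        uvLinD klE0 (1 + ((e.1 : ℕ) + (e.2 : ℕ))) * (B * ((1 + ((e.1 : ℕ) + (e.2 : ℕ)) + 3).factorial : ℝ) *
          (4 / klE0) ^ (1 + ((e.1 : ℕ) + (e.2 : ℕ)) + 2) *
          (4608 * (1 + R.Gfr 0 + R.Gfr 1 + R.Gfr 2 + R.Gfr 3) ^ 4 * (U ^ 2 + |U| * (1 / 2 : ℝ) ^ m))) :=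
        add_le_add (mul_le_mul_of_nonneg_left hV hV0) (mul_le_mul_of_nonneg_left hD hD0)
    _ = _ := by ring

/-- **The first space moment of the BARE piece** (band `e − μ`, scale `R = 1`):
`(β/N)·Σ|b̃_l|·‖S[G_{e−μ}]‖ ≤ uvSpaceMomentConst e₀ 1 (uvPieceSq e₀ (uvBaseQ B e₀ 4) (uvBaseQ′ B e₀ 4))`. -/
theorem spaceMoment_basePiece_frame_le (hβ2 : 2 ≤ β) (hβM : β ^ 3 ≤ (M : ℝ)) (hMN : 2 * M ≤ N) (hB1 : 1 ≤ B)
    (hB : ∀ i ≤ 5, ∀ t, ‖iteratedDeriv i salmhoferCutoff t‖ ≤ B) (μ : ℝ) {l l' : Fin 2} (hll' : l ≠ l') :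
    β / N * ∑ a : TorusSite 1 N, ∑ bv : TorusSite 2 L,
        |(((bv l).valMinAbs : ℤ) : ℝ)| *
          ‖∑ q₀ : TorusSite 1 N, ∑ qv : TorusSite 2 L, torusChar q₀ a * torusChar qv bv *
            uvGridSymbolBand L M N β klE0 (fun y => frameLevel μ 0 (WithLp.toLp 2 (latticeMomentum L y))) q₀ qv‖ ≤
      uvSpaceMomentConst klE0 1 (uvPieceSq klE0 (uvBaseQ B klE0 4) (uvBaseQ' B klE0 4)) := by
  obtain ⟨hΛ, hΛ4⟩ := klE0_pos_le_four
  have hper : ∀ (p : Fin 2 → ℝ) (z : Fin 2 → ℤ),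
      frameLevel μ 0 (WithLp.toLp 2 (fun i => p i + z i * (2 * Real.pi))) = frameLevel μ 0 (WithLp.toLp 2 p) := by
    intro p z; rw [frameLevel_toLp_eq_ctBandFn, frameLevel_toLp_eq_ctBandFn, ctBandFn_periodic]
  exact spaceMoment_basePiece_le (L := L) (M := M) (N := N) hβ2 hΛ hΛ4 hβM hMN hB1 hB le_rfl (contDiff_frameLevel μ 0) hper
    (D := 4) (fun i hi1 _ x => norm_iteratedFDeriv_frameLevel_zero_le_pow μ hi1 x) hll' le_rfl

end Frame

/-! ## §4 The export: telescoping over the frame pieces -/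

/-- **The first SPACE moment of the scale-`0` covariance of an admissible frame**, uniform in `M`, `β`, `L` and the frame, in the grid
units (`(β/N)` = the weight of a grid vertex): for `FrameOK R U N_sc μ K`, `R.WF`, `|U| ≤ 1`, `klBetaMin ≤ β`, `β³ ≤ M`, `2M ≤ N`, cutoff
derivatives `≤ B` up to order `5`, and `l ≠ l'`,
`(β/N)·Σ_{a,b⃗} |b̃_l|·‖S[G_σ](a,b⃗)‖ ≤ C₀(B) + C_lin(B)·4608·(1 + ΣGfr)⁴·((N_sc + 1)·U² + 2|U|)`.
The `O(U²)` slope times `N_sc + 1` is `O(c)` in the regime `β ≤ e^{c/U²}` (`sq_mul_nScales_succ_le`). -/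
theorem spaceMoment_scaleZero_of_frameOK [NeZero L] [NeZero M] [NeZero N] {R : RenConsts} {U μ β : ℝ} {Nsc : ℕ} {K : TrigPolyC4v}
    (hK : FrameOK R U Nsc μ K) (hRwf : R.WF) (hU1 : |U| ≤ 1) (hβ : klBetaMin ≤ β) (hβM : β ^ 3 ≤ (M : ℝ)) (hMN : 2 * M ≤ N)
    {B : ℝ} (hB1 : 1 ≤ B) (hB : ∀ i ≤ 5, ∀ t, ‖iteratedDeriv i salmhoferCutoff t‖ ≤ B) {l l' : Fin 2} (hll' : l ≠ l') (σ : Fin 2) :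
    β / N * ∑ a : TorusSite 1 N, ∑ bv : TorusSite 2 L,
        |(((bv l).valMinAbs : ℤ) : ℝ)| *
          ‖∑ q₀ : TorusSite 1 N, ∑ qv : TorusSite 2 L, torusChar q₀ a * torusChar qv bv *
            gridSymbol L M N β (uvSymbolCT L M β μ K klE0) σ q₀ qv‖ ≤
      uvSpaceMomentConst klE0 1 (uvPieceSq klE0 (uvBaseQ B klE0 4) (uvBaseQ' B klE0 4)) +
        (1 / 4 * Real.sqrt (216 * (1 / klE0 + 1 / 2)) *
            ∑ e : Fin 2 × Fin 2, (uvLinV klE0 (1 + (e.1 : ℕ) + (e.2 : ℕ)) *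
                (B * ((1 + ((e.1 : ℕ) + (e.2 : ℕ)) + 2).factorial : ℝ) * (4 / klE0) ^ (1 + ((e.1 : ℕ) + (e.2 : ℕ)) + 1)) +
              uvLinD klE0 (1 + (e.1 : ℕ) + (e.2 : ℕ)) *
                (B * ((1 + ((e.1 : ℕ) + (e.2 : ℕ)) + 3).factorial : ℝ) * (4 / klE0) ^ (1 + ((e.1 : ℕ) + (e.2 : ℕ)) + 2)))) *
          (4608 * (1 + R.Gfr 0 + R.Gfr 1 + R.Gfr 2 + R.Gfr 3) ^ 4 * (((Nsc : ℝ) + 1) * U ^ 2 + 2 * |U|)) := by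
  obtain ⟨-, Kp, hsum, hS⟩ := hK
  have hβ2 : (2 : ℝ) ≤ β := le_trans (by norm_num [klBetaMin]) hβ
  have hβ0 : 0 < β := by linarith
  have hNpos : (0 : ℝ) < N := by exact_mod_cast Nat.pos_of_ne_zero (NeZero.ne N)
  -- the symbol is the last telescoping symbol
  set G : ℕ → TorusSite 1 N → TorusSite 2 L → ℂ := fun m =>
    uvGridSymbolBand L M N β klE0 (fun y => frameLevel μ 0 (WithLp.toLp 2 (latticeMomentum L y)) -
      ∑ n ∈ range m, evalM (Kp n) (WithLp.toLp 2 (latticeMomentum L y))) with hGdef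
  have hsym : gridSymbol L M N β (uvSymbolCT L M β μ K klE0) σ = G (Nsc + 1) := by
    rw [gridSymbol_uvSymbolCT_eq_uvGridSymbolBand hβ0, nambuXiCT_eq_frameBandSeq_last (L := L) μ hsum]
  rw [hsym]
  -- telescoping of the weighted `ℓ¹` norm
  set w : TorusSite 1 N → TorusSite 2 L → ℝ := fun _ bv => |(((bv l).valMinAbs : ℤ) : ℝ)| with hw
  have hw0 : ∀ a bv, 0 ≤ w a bv := fun a bv => abs_nonneg _
  have htel := sum_sum_wt_norm_charSum_telescope_le w hw0 G (Nsc + 1)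
  simp only [hw] at htel
  refine (mul_le_mul_of_nonneg_left htel (by positivity)).trans ?_
  rw [mul_add]
  refine add_le_add ?_ ?_
  · -- the bare piece
    have hG0 : G 0 = uvGridSymbolBand L M N β klE0 (fun y => frameLevel μ 0 (WithLp.toLp 2 (latticeMomentum L y))) := by
      simp only [hGdef, sum_range_zero, sub_zero]
    rw [hG0]
    exact spaceMoment_basePiece_frame_le (L := L) (M := M) (N := N) hβ2 hβM hMN hB1 hB μ hll'
  · -- the increments, summed over `m ≤ N_sc`
    have hincr : ∀ m ∈ range (Nsc + 1), β / N * ∑ a : TorusSite 1 N, ∑ bv : TorusSite 2 L,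
        |(((bv l).valMinAbs : ℤ) : ℝ)| * ‖∑ q₀ : TorusSite 1 N, ∑ qv : TorusSite 2 L, torusChar q₀ a * torusChar qv bv *
          (G (m + 1) - G m) q₀ qv‖ ≤
        (1 / 4 * Real.sqrt (216 * (1 / klE0 + 1 / 2)) *
            ∑ e : Fin 2 × Fin 2, (uvLinV klE0 (1 + (e.1 : ℕ) + (e.2 : ℕ)) *
                (B * ((1 + ((e.1 : ℕ) + (e.2 : ℕ)) + 2).factorial : ℝ) * (4 / klE0) ^ (1 + ((e.1 : ℕ) + (e.2 : ℕ)) + 1)) +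
              uvLinD klE0 (1 + (e.1 : ℕ) + (e.2 : ℕ)) *
                (B * ((1 + ((e.1 : ℕ) + (e.2 : ℕ)) + 3).factorial : ℝ) * (4 / klE0) ^ (1 + ((e.1 : ℕ) + (e.2 : ℕ)) + 2)))) *
          (4608 * (1 + R.Gfr 0 + R.Gfr 1 + R.Gfr 2 + R.Gfr 3) ^ 4 * (U ^ 2 + |U| * (1 / 2 : ℝ) ^ m)) := by
      intro m hm
      have hm' : m ≤ Nsc := Nat.lt_succ_iff.1 (mem_range.1 hm)
      exact spaceMoment_incrPiece_frame_le (L := L) (M := M) (N := N) hRwf hU1 hS hβ2 hβM hMN hB1 hB hm' hll'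
    rw [mul_sum]
    refine (sum_le_sum hincr).trans ?_
    rw [← mul_sum, ← mul_sum]
    refine mul_le_mul_of_nonneg_left (mul_le_mul_of_nonneg_left ?_ (by positivity)) ?_
    · -- `Σ_{m ≤ N_sc} (U² + |U|/2ᵐ) ≤ (N_sc+1)U² + 2|U|`
      rw [sum_add_distrib, sum_const, card_range, nsmul_eq_mul, ← mul_sum]
      have hgeo : ∑ m ∈ range (Nsc + 1), (1 / 2 : ℝ) ^ m ≤ 2 := by
        rw [geom_sum_eq (by norm_num) (Nsc + 1)]
        have : 0 ≤ (1 / 2 : ℝ) ^ (Nsc + 1) := by positivity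
        have h : ((1 / 2 : ℝ) ^ (Nsc + 1) - 1) / (1 / 2 - 1) = 2 * (1 - (1 / 2 : ℝ) ^ (Nsc + 1)) := by field_simp; ring
        rw [h]; nlinarith
      push_cast
      nlinarith [abs_nonneg U, hgeo]
    · have hΛ := klE0_pos_le_four.1
      have hB0 : 0 ≤ B := zero_le_one.trans hB1
      refine mul_nonneg (by positivity) (sum_nonneg fun e _ => ?_)
      have h1 := uvLinV_nonneg hΛ (1 + (e.1 : ℕ) + (e.2 : ℕ))
      have h2 := uvLinD_nonneg hΛ (1 + (e.1 : ℕ) + (e.2 : ℕ))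
      positivity

end Summit.HubbardSuperconductivity.HubbardSuperconductivity.Theorems.EngineV8

end
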